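import Summits.Ventures.QEC.Census.LRATLeavesBB
import Summits.Ventures.QEC.Census.BB.BB72KBRank
import Summits.Ventures.QEC.Census.BB.BB72KBCover
import HarnessLib

/-!
# `[[72,12,6]]` lower bound by KERNEL B (SAT/LRAT), `Z` side, flat indices

Cell `qec`, route `BB72DistanceCertificate` (supporting evidence for item `NoZLogicalBelowSix`, which is
CLOSED by the kernel-A certificate `Theorems/BB72DistanceCertificateNoZLogicalBelowSix.lean`, p466744 — the
gate's dedup rule forbids re-proving that literal statement, so this file states the kernel-B result in the
FLAT index convention the certificates use).  Every flat `Z`-logical `w : Fin 72 → 𝔽₂` of the typed code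
`BB.bb72` (`HXFlat w = 0`, `w ∉ rs HZFlat`) has Hamming weight `≥ 6`, derived from qec-search-2's kernel-B
certificate 2329a660016ec77c: 72 `Z`-side leaf CNFs + 2 completeness CNFs refuted by CaDiCaL, the LRAT
proofs replayed IN THE KERNEL by `KRup` (`Census/KernelReplay.lean`; modules `Census/BB/BB72KBLeavesZ*.lean`,
`BB72KBCover.lean`, emitter qec-search-10) against CNFs generated in Lean by the `enc-v1` encoder with proved
ENCODING SOUNDNESS (`Census/CNFEncode*.lean`), the assembly `Census/LRATLeavesBB.lean`, the completeness of
the certificate's `X`-logical basis from `decide`d rank certificates (`Census/BB/BB72KBRank.lean`), and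
type-12's translation-orbit pin lemma.  Tier KERNEL-std (axioms standard; no `native_decide`).  The `X` side
is `Census/BB/BB72KBLowerX.lean`.
-/

namespace Summit.Ventures.QEC.Census.BB72KB

open Matrix Literature.InformationTheory.QuantumCodes Summit.Ventures.QEC.Census
open Summit.Ventures.QEC.Census.LRATBridge

/-- **Pinned flat `Z`-logicals of `BB.bb72` have weight `≥ 6` (kernel B)**: every `w` with `HXFlat w = 0`,
`w ∉ rs HZFlat` and (bit `0` set, or bits `0…35` clear and bit `36` set) has `6 ≤ ‖w‖` — the two cases of
the `enc-v2` certificate, each closed by 36 kernel-replayed leaf refutations and a coverage refutation. -/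
theorem bb72_pinnedZLogical_ge_six_kernelB : ∀ w : Fin (6 * 6 + 6 * 6) → ZMod 2,
    BB.bb72.HXFlat *ᵥ w = 0 → w ∉ rowSpace BB.bb72.HZFlat →
    (w (BB.Code.qubitIndex (Sum.inl 0)) ≠ 0 ∨
      ((∀ i : Fin (6 * 6 + 6 * 6), (i : ℕ) < 6 * 6 → w i = 0) ∧ w (BB.Code.qubitIndex (Sum.inr 0)) ≠ 0)) →
    6 ≤ hammingNorm w :=
  BB.bb72.le_hammingNorm_of_kernelB_pinned (d := 6) lxVec hlogZ_bb72 HX LX rowSupports_bb72_HXFlat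
    supports_lxVec cubesZ0 cubesZ1 leavesZ0 leavesZ1 coverZ0_unsat coverZ1_unsat cubesZ0_lt cubesZ1_lt

/-- **No flat `Z`-logical of `BB.bb72` below weight 6 (kernel B)**: the pin removed by type-12's
`exists_zLogicalFlat_pinned` (translation invariance of `QC(A,B)`). -/
theorem bb72_noZLogicalBelowSix_flat_kernelB : ∀ w : Fin (6 * 6 + 6 * 6) → ZMod 2,
    BB.bb72.HXFlat *ᵥ w = 0 → w ∉ rowSpace BB.bb72.HZFlat → 6 ≤ hammingNorm w := by
  intro w hw hw'
  obtain ⟨u, hu, hu', hwt, hpin⟩ := BB.bb72.exists_zLogicalFlat_pinned hw hw'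
  rw [← hwt]
  exact bb72_pinnedZLogical_ge_six_kernelB u hu hu' hpin

/-- Hence `6 ≤ d^Z(BB.bb72.css)` by kernel B, through the flat bridge `BB.Code.zLowerBound_of_flat`
(existence of a `Z`-logical as the guard hypothesis of `CSSCode.le_dZ`). -/
theorem bb72_six_le_dZ_kernelB
    (hex : ∃ v : BB.Mono 6 6 ⊕ BB.Mono 6 6 → ZMod 2, BB.bb72.css.HX *ᵥ v = 0 ∧ v ∉ BB.bb72.css.rowSpZ) :
    6 ≤ BB.bb72.css.dZ :=
  BB.bb72.css.le_dZ hex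
    (BB.bb72.zLowerBound_of_flat (D := BB.bb72.cssFlat) rfl rfl bb72_noZLogicalBelowSix_flat_kernelB)

end Summit.Ventures.QEC.Census.BB72KB
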